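import Summits.QuantumFields.QCD.Theses.GapBuysCauchyRate
import Literature.MathematicalPhysics.QuantumFieldTheory.DiagonalLatticeClustering
import Literature.MathematicalPhysics.QuantumFieldTheory.MassGapFromLatticeClustering
import Literature.MathematicalPhysics.QuantumFieldTheory.OSReconstructionNoE1
import Literature.MathematicalPhysics.QuantumFieldTheory.QCDAsymptoticScalingCouplingDivergence
import Summits.QuantumFields.QCD.Theorems.QuarksAsStableActionStableActionBridgeDefs
import Summits.QuantumFields.QCD.Theorems.GapBuysCauchyRateConvergentOSClosureStubGapTransfer
import Summits.QuantumFields.QCD.Theorems.GapBuysCauchyRateConvergentOSClosureStubSpeciesPackaging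
import Summits.QuantumFields.QCD.Theorems.GapBuysCauchyRateConvergentOSClosureStubAsymptoticTranslation
import Summits.QuantumFields.QCD.Theorems.GapBuysCauchyRateConvergentOSClosureStubSoftClosure
import Summits.QuantumFields.QCD.Theorems.GapBuysCauchyRateConvergentOSClosureStubRpOfComparison
import HarnessLib.Audit

/-!
# Skeleton for crux `ConvergentOSClosure` (item stmt-QuantumFields-11525), line `birth` — lead reshape 4 (final after wave 3)

Route `route-QuantumFields-GapBuysCauchyRate` (sub-problem QCD), crux decl
`Summit.QuantumFields.QCD.Theses.GapBuysCauchyRate.ConvergentOSClosure`.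
Lead prover `prover-line-stmt-QuantumFields-11525-0`, 2026-08-17.

History.  Birth (registrar): S1 tempered extension, S2 reflection axioms, S3 species diagonal clustering, S4 gap
transfer, S5 packaging.  Reshape 1 (lead): explicit self-contained stub signatures.  Wave 1: S4 LANDED
(p147450, `Theorems/GapBuysCauchyRateConvergentOSClosureStubGapTransfer.lean`), S5 LANDED (p147393,
`…StubSpeciesPackaging.lean`), S3 `stub-misstated` (the per-pair `HasLatticeMassGap` hypothesis is idle for the
smeared species fields — YangMills `GapToContinuum` defects D2/D3 verbatim; PROVED once the norm-form
`HasSpeciesCSClustering` is the hypothesis), S2 `stub-blocked` (E2/E4 of the limit need lattice inputs the crux does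
not carry: eventually approximately positive OS forms of the own-torus functional and k-uniform spatial clustering).

Reshapes 2–3 (this file) re-cut the crux along the LATTICE PACKAGE of the sibling crux `StableActionBridge`
(stmt-QuantumFields-9737; landed `Theorems/QuarksAsStableActionStableActionBridgeSoftClosure{Limit,QCD,Canonical,Tensor}.lean`,
`…Defs.lean: qcdLatticeDist`), so that every open stub is ONE named lattice-side input in tree vocabulary and the whole
soft part is one provable stub.  STATUS after wave 2: CLOSED MODULO the four open stubs T, RP, CL, CS —
exactly the lattice-side inputs that the crux hypotheses do not supply (see `Restatement.lean` in this crux directory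
and the analyses attached to the item):

* `stub_tightness` (T, OPEN — UV / calibrated tightness, lead): crux hypotheses ⇒ a k-uniform E0′ bound on `⁰𝒮` for the
  canonical lattice distributions `qcdLatticeDist (𝒞.scheme m) k` (P2 of 9737's package).
* `stub_asymptoticTranslation` (AT) — CLOSED (wave 2, p149834, `Theorems/…StubAsymptoticTranslation.lean`): crux hypotheses +
  the E0′ bound (P2) ⇒ asymptotic translation invariance of `qcdLatticeDist` on `⁰𝒮` (P6), by exact torus translation
  covariance on test functions cut off inside the box + 3ε.
* RP (P8, eventually approximately positive OS forms) is split by reshape 4 into `stub_thermalComparison` (RP-COMP, OPEN, `N_f ≤ 16`: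
  the E0′-norm comparison periodic ↔ Θ-symmetrised thermal distributions — the primitive finite-volume input),
  `stub_rpOfComparison` (RP-b — CLOSED wave 3, p152669: P2 + comparison + 9737's landed `stub_rpOfSymThermal` ⇒ P8) and
  `stub_approxPositiveFormsLargeNf` (RP-NEG, the junk corner `N_f ≥ 17`, `β_k → −∞`).
* `stub_spatialClustering` (CL, OPEN): the same ⇒ k-uniform spatial clustering (P9).
* `stub_speciesCSClustering` (CS, OPEN): the same with the gap at `Δ` ⇒ `HasSpeciesCSClustering Δ'` for some `Δ' > 0` (P10).
* `stub_softClosure` (SOFT) — CLOSED (wave 2, p150754, `Theorems/…StubSoftClosure.lean`): scheme-generic — convergence + P2 + P6 + P8 +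
  P9 + gap `Δ` + CS `Δ'` ⇒ the crux's conclusion minus the packaging clause (limit functionals by Hahn–Banach, inheritance of
  E0/E0′/translations/E2/E3/E4, hermiticity from E2, the species gap BEFORE rotations by the landed `stub_gapTransfer`);
  the packaging clause is supplied in the composition by the landed `stub_speciesPackaging`.  (Reshape 3 exists because the
  reshape-2 SOFT statement, 4816 characters, was registered TRUNCATED at 3900 characters and could never be matched.)
* `stub_gapTransfer`, `stub_speciesPackaging` — CLOSED (kept, proved by the landed theorems; used inside SOFT's proof).

`convergentOSClosure_of_stubs : ConvergentOSClosure` is kernel-checked from the stubs (no `sorry` outside `stub_*`).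
-/

noncomputable section

namespace Summit.QuantumFields.QCD.Cruxes.ConvergentOSClosure.Birth

open scoped BigOperators Topology
open MeasureTheory Filter
open Literature.MathematicalPhysics.AQFT Literature.MathematicalPhysics.QuantumLattice
  Literature.MathematicalPhysics.QuantumFieldTheory
open Summit.QuantumFields.QCD.Cruxes.StableActionBridge.Sketch (qcdLatticeDist qcdLatticeDistSymAP)
open Summit.QuantumFields.QCD.Theses.GapBuysCauchyRate (ConvergentOSClosure)

/-! ## §1 The registered stubs (signatures explicit and self-contained) -/

/-- (T) **calibrated tightness** — OPEN (UV; held by the lead): the crux hypotheses give a k-uniform E0′ bound on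
`⁰𝒮` for the canonical lattice distributions of the calibrated scheme (P2 of the `StableActionBridge` package). -/
theorem stub_tightness :
    ∀ (Nf : ℕ) (reg : QCDRegularisation Nf) (𝒞 : CalibratedSpeciesFamily reg) (m : Fin Nf → ℝ),
    (∀ f, 0 < m f) → (𝒞.scheme m).HasAsymptoticScaling →
    (∀ fl : Fin Nf, ∀ᶠ k in Filter.atTop, -1 < (𝒞.scheme m).mq fl k) →
    (∃ Δ > 0, (𝒞.scheme m).HasLatticeMassGap Δ) →
    (∀ᶠ k in Filter.atTop,
      (𝒞.scheme m).twoPoint k QCDField.glue QCDField.glue (thetaTest 4 𝒞.f₀) 𝒞.f₀ = 1) →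
    (∀ f g : Fin Nf, f ≠ g → ∀ᶠ k in Filter.atTop,
      (𝒞.scheme m).twoPoint k (QCDField.pseudoRe f g) (QCDField.pseudoRe f g)
        (thetaTest 4 𝒞.f₀) 𝒞.f₀ = 1) →
    (∀ n : ℕ, n ≠ 0 → ∀ (σ : Fin n → QCDField Nf)
      (f : Fin n → SchwartzMap (EuclideanSpace ℝ (Fin 4)) ℝ) (F : SchwartzMap (Fin n → EuclideanSpace ℝ (Fin 4)) ℂ),
      IsTensorOf F (fun i => ofRealTest (f i)) → IsOffDiagonal F →
        ∃ c : ℂ, Filter.Tendsto (fun k : ℕ => qcdLatticeSchwinger (𝒞.scheme m) k n σ f)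
          Filter.atTop (nhds c)) →
    ∃ (s : ℕ) (α β : ℝ), 0 ≤ α ∧
      (∀ (n : ℕ) (σ : Fin n → QCDField Nf), ∀ᶠ k in Filter.atTop,
        ∀ F : SchwartzMap (Fin n → EuclideanSpace ℝ (Fin 4)) ℂ, IsOffDiagonal F →
          ‖qcdLatticeDist (𝒞.scheme m) k n σ F‖ ≤ α * (n.factorial : ℝ) ^ β * schwartzNorm (n * s) F) := by
  sorry

/-- (AT) **asymptotic translation invariance on `⁰𝒮`** — CLOSED (wave 2, p149834): along the calibrated scheme, GIVEN the
k-uniform E0′ bound (P2), the canonical lattice distributions become translation invariant on off-diagonal test functions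
(P6): exact covariance of the periodic torus functional under lattice translations for test functions supported inside the
physical box, Schwartz tails + P2 for the cut-off remainder, `a_k ℤ⁴ ∋ a_k v_k → a` + P2-equicontinuity. -/
theorem stub_asymptoticTranslation :
    ∀ (Nf : ℕ) (reg : QCDRegularisation Nf) (𝒞 : CalibratedSpeciesFamily reg) (m : Fin Nf → ℝ),
    (∀ f, 0 < m f) → (𝒞.scheme m).HasAsymptoticScaling →
    (∀ fl : Fin Nf, ∀ᶠ k in Filter.atTop, -1 < (𝒞.scheme m).mq fl k) →
    (∃ Δ > 0, (𝒞.scheme m).HasLatticeMassGap Δ) →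
    (∀ᶠ k in Filter.atTop,
      (𝒞.scheme m).twoPoint k QCDField.glue QCDField.glue (thetaTest 4 𝒞.f₀) 𝒞.f₀ = 1) →
    (∀ f g : Fin Nf, f ≠ g → ∀ᶠ k in Filter.atTop,
      (𝒞.scheme m).twoPoint k (QCDField.pseudoRe f g) (QCDField.pseudoRe f g)
        (thetaTest 4 𝒞.f₀) 𝒞.f₀ = 1) →
    (∀ n : ℕ, n ≠ 0 → ∀ (σ : Fin n → QCDField Nf)
      (f : Fin n → SchwartzMap (EuclideanSpace ℝ (Fin 4)) ℝ) (F : SchwartzMap (Fin n → EuclideanSpace ℝ (Fin 4)) ℂ),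
      IsTensorOf F (fun i => ofRealTest (f i)) → IsOffDiagonal F →
        ∃ c : ℂ, Filter.Tendsto (fun k : ℕ => qcdLatticeSchwinger (𝒞.scheme m) k n σ f)
          Filter.atTop (nhds c)) →
    ∀ (s : ℕ) (α β : ℝ), 0 ≤ α →
      (∀ (n : ℕ) (σ : Fin n → QCDField Nf), ∀ᶠ k in Filter.atTop,
        ∀ F : SchwartzMap (Fin n → EuclideanSpace ℝ (Fin 4)) ℂ, IsOffDiagonal F →
          ‖qcdLatticeDist (𝒞.scheme m) k n σ F‖ ≤ α * (n.factorial : ℝ) ^ β * schwartzNorm (n * s) F) →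
    (∀ (n : ℕ) (σ : Fin n → QCDField Nf) (a : EuclideanSpace ℝ (Fin 4)) (F : SchwartzMap (Fin n → EuclideanSpace ℝ (Fin 4)) ℂ),
      IsOffDiagonal F →
        Filter.Tendsto (fun k : ℕ => qcdLatticeDist (𝒞.scheme m) k n σ (translateMulti a F) -
          qcdLatticeDist (𝒞.scheme m) k n σ F) Filter.atTop (nhds 0)) :=
  Summit.QuantumFields.QCD.Theorems.ConvergentOSClosure.stub_asymptoticTranslation

/-- (RP-COMP) **thermal / boundary-condition comparison in E0′ norm** — OPEN (finite volume; `N_f ≤ 16`): along a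
two-loop-AF scheme on the physical branch with a uniform lattice gap and convergent `n`-point functions obeying the E0′
bound (P2), the canonical lattice distributions of the time-PERIODIC own-torus functional and of the thermal
Θ-symmetrised functional (`qcdLatticeDistSymAP`, sibling crux StableActionBridge) become ε-close in the same E0′ norm,
uniformly on `⁰𝒮`, eventually in `k` (the pointwise version is 9737's P12′).  This is the primitive lattice input behind
reflection positivity of the limit. -/
theorem stub_thermalComparison :
    ∀ (Nf : ℕ) (sch : QCDScheme Nf), Nf ≤ 16 → sch.HasAsymptoticScaling →
    (∀ fl : Fin Nf, ∀ᶠ k in Filter.atTop, -1 < sch.mq fl k) →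
    (∃ Δ > 0, sch.HasLatticeMassGap Δ) →
    (∀ n : ℕ, n ≠ 0 → ∀ (σ : Fin n → QCDField Nf)
      (f : Fin n → SchwartzMap (EuclideanSpace ℝ (Fin 4)) ℝ) (F : SchwartzMap (Fin n → EuclideanSpace ℝ (Fin 4)) ℂ),
      IsTensorOf F (fun i => ofRealTest (f i)) → IsOffDiagonal F →
        ∃ c : ℂ, Filter.Tendsto (fun k : ℕ => qcdLatticeSchwinger sch k n σ f)
          Filter.atTop (nhds c)) →
    ∀ (s : ℕ) (α β : ℝ), 0 ≤ α →
      (∀ (n : ℕ) (σ : Fin n → QCDField Nf), ∀ᶠ k in Filter.atTop,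
        ∀ F : SchwartzMap (Fin n → EuclideanSpace ℝ (Fin 4)) ℂ, IsOffDiagonal F →
          ‖qcdLatticeDist sch k n σ F‖ ≤ α * (n.factorial : ℝ) ^ β * schwartzNorm (n * s) F) →
    (∀ ε : ℝ, 0 < ε → ∀ (n : ℕ) (σ : Fin n → QCDField Nf), ∀ᶠ k in Filter.atTop,
      ∀ F : SchwartzMap (Fin n → EuclideanSpace ℝ (Fin 4)) ℂ, IsOffDiagonal F →
        ‖qcdLatticeDistSymAP sch k n σ F - qcdLatticeDist sch k n σ F‖ ≤ ε * schwartzNorm (n * s) F) := by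
  sorry

/-- (RP-b) **approximately positive OS forms from the comparison** — CLOSED (wave 3, p152669, `Theorems/…StubRpOfComparison.lean`): for a scheme with eventually
non-negative couplings and bare masses on the physical branch, the E0′ bound (P2) and the E0′-norm comparison with the
Θ-symmetrised thermal distributions give eventually approximately positive OS forms (P8) of the periodic distributions:
P2 + comparison ⇒ an E0′ bound for `qcdLatticeDistSymAP`, the landed `stub_rpOfSymThermal` (stmt-9737) ⇒ P8 for the
symmetrised forms, and the comparison once more on the finitely many witnesses `H i j ∈ ⁰𝒮`. -/
theorem stub_rpOfComparison :
    ∀ (Nf : ℕ) (sch : QCDScheme Nf), (∀ᶠ k in Filter.atTop, 0 ≤ sch.β k) →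
    (∀ fl : Fin Nf, ∀ᶠ k in Filter.atTop, -1 < sch.mq fl k) →
    ∀ (s : ℕ) (α β : ℝ), 0 ≤ α →
      (∀ (n : ℕ) (σ : Fin n → QCDField Nf), ∀ᶠ k in Filter.atTop,
        ∀ F : SchwartzMap (Fin n → EuclideanSpace ℝ (Fin 4)) ℂ, IsOffDiagonal F →
          ‖qcdLatticeDist sch k n σ F‖ ≤ α * (n.factorial : ℝ) ^ β * schwartzNorm (n * s) F) →
    (∀ ε : ℝ, 0 < ε → ∀ (n : ℕ) (σ : Fin n → QCDField Nf), ∀ᶠ k in Filter.atTop,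
      ∀ F : SchwartzMap (Fin n → EuclideanSpace ℝ (Fin 4)) ℂ, IsOffDiagonal F →
        ‖qcdLatticeDistSymAP sch k n σ F - qcdLatticeDist sch k n σ F‖ ≤ ε * schwartzNorm (n * s) F) →
    (∀ (N : ℕ) (deg : Fin N → ℕ) (lab : (j : Fin N) → Fin (deg j) → QCDField Nf)
      (G : (j : Fin N) → SchwartzMap (Fin (deg j) → EuclideanSpace ℝ (Fin 4)) ℂ), (∀ j, IsTimeOrdered (G j)) →
      ∀ H : (i j : Fin N) → SchwartzMap (Fin (deg i + deg j) → EuclideanSpace ℝ (Fin 4)) ℂ,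
        (∀ i j, IsAppendTensorOf (H i j) (osAdjoint (G i)) (G j)) →
        ∀ ε : ℝ, 0 < ε → ∀ᶠ l in Filter.atTop,
          -ε ≤ (∑ i, ∑ j, qcdLatticeDist sch l (deg i + deg j)
            (Fin.append (lab i ∘ Fin.rev) (lab j)) (H i j)).re ∧
          |(∑ i, ∑ j, qcdLatticeDist sch l (deg i + deg j)
            (Fin.append (lab i ∘ Fin.rev) (lab j)) (H i j)).im| ≤ ε) :=
  Summit.QuantumFields.QCD.Theorems.ConvergentOSClosure.stub_rpOfComparison

/-- (RP-NEG) **the `N_f ≥ 17` corner** — OPEN and JUNK: for `N_f ≥ 17` asymptotic scaling forces `β_k → −∞`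
(`betaCoeff₀ < 0`), a regime in which nothing is known about lattice QCD; the crux quantifies over all `N_f` although the
problem statement uses only `N_f = 2, 3`.  Same conclusion P8, isolated so that a re-typing can simply drop it. -/
theorem stub_approxPositiveFormsLargeNf :
    ∀ (Nf : ℕ) (sch : QCDScheme Nf), 17 ≤ Nf → sch.HasAsymptoticScaling →
    (∀ fl : Fin Nf, ∀ᶠ k in Filter.atTop, -1 < sch.mq fl k) →
    (∃ Δ > 0, sch.HasLatticeMassGap Δ) →
    (∀ n : ℕ, n ≠ 0 → ∀ (σ : Fin n → QCDField Nf)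
      (f : Fin n → SchwartzMap (EuclideanSpace ℝ (Fin 4)) ℝ) (F : SchwartzMap (Fin n → EuclideanSpace ℝ (Fin 4)) ℂ),
      IsTensorOf F (fun i => ofRealTest (f i)) → IsOffDiagonal F →
        ∃ c : ℂ, Filter.Tendsto (fun k : ℕ => qcdLatticeSchwinger sch k n σ f)
          Filter.atTop (nhds c)) →
    ∀ (s : ℕ) (α β : ℝ), 0 ≤ α →
      (∀ (n : ℕ) (σ : Fin n → QCDField Nf), ∀ᶠ k in Filter.atTop,
        ∀ F : SchwartzMap (Fin n → EuclideanSpace ℝ (Fin 4)) ℂ, IsOffDiagonal F →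
          ‖qcdLatticeDist sch k n σ F‖ ≤ α * (n.factorial : ℝ) ^ β * schwartzNorm (n * s) F) →
    (∀ (N : ℕ) (deg : Fin N → ℕ) (lab : (j : Fin N) → Fin (deg j) → QCDField Nf)
      (G : (j : Fin N) → SchwartzMap (Fin (deg j) → EuclideanSpace ℝ (Fin 4)) ℂ), (∀ j, IsTimeOrdered (G j)) →
      ∀ H : (i j : Fin N) → SchwartzMap (Fin (deg i + deg j) → EuclideanSpace ℝ (Fin 4)) ℂ,
        (∀ i j, IsAppendTensorOf (H i j) (osAdjoint (G i)) (G j)) →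
        ∀ ε : ℝ, 0 < ε → ∀ᶠ l in Filter.atTop,
          -ε ≤ (∑ i, ∑ j, qcdLatticeDist sch l (deg i + deg j)
            (Fin.append (lab i ∘ Fin.rev) (lab j)) (H i j)).re ∧
          |(∑ i, ∑ j, qcdLatticeDist sch l (deg i + deg j)
            (Fin.append (lab i ∘ Fin.rev) (lab j)) (H i j)).im| ≤ ε) := by
  sorry

/-- (CL) **k-uniform spatial clustering** — OPEN (infrared, the E4 input): same hypotheses (incl. P2) ⇒ the truncated
lattice functions along a spatial direction are eventually (in `k`) `≤ ε` beyond a `k`-independent distance (P9). -/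
theorem stub_spatialClustering :
    ∀ (Nf : ℕ) (sch : QCDScheme Nf), sch.HasAsymptoticScaling →
    (∀ fl : Fin Nf, ∀ᶠ k in Filter.atTop, -1 < sch.mq fl k) →
    (∃ Δ > 0, sch.HasLatticeMassGap Δ) →
    (∀ n : ℕ, n ≠ 0 → ∀ (σ : Fin n → QCDField Nf)
      (f : Fin n → SchwartzMap (EuclideanSpace ℝ (Fin 4)) ℝ) (F : SchwartzMap (Fin n → EuclideanSpace ℝ (Fin 4)) ℂ),
      IsTensorOf F (fun i => ofRealTest (f i)) → IsOffDiagonal F →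
        ∃ c : ℂ, Filter.Tendsto (fun k : ℕ => qcdLatticeSchwinger sch k n σ f)
          Filter.atTop (nhds c)) →
    ∀ (s : ℕ) (α β : ℝ), 0 ≤ α →
      (∀ (n : ℕ) (σ : Fin n → QCDField Nf), ∀ᶠ k in Filter.atTop,
        ∀ F : SchwartzMap (Fin n → EuclideanSpace ℝ (Fin 4)) ℂ, IsOffDiagonal F →
          ‖qcdLatticeDist sch k n σ F‖ ≤ α * (n.factorial : ℝ) ^ β * schwartzNorm (n * s) F) →
    (∀ (n n' : ℕ) (σ : Fin n → QCDField Nf) (σ' : Fin n' → QCDField Nf)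
      (F : SchwartzMap (Fin n → EuclideanSpace ℝ (Fin 4)) ℂ) (G : SchwartzMap (Fin n' → EuclideanSpace ℝ (Fin 4)) ℂ),
      IsTimeOrdered F → IsTimeOrdered G → ∀ a : EuclideanSpace ℝ (Fin 4), a 0 = 0 → a ≠ 0 →
      ∀ ε : ℝ, 0 < ε → ∃ t₀ : ℝ, ∀ t : ℝ, t₀ ≤ t →
        ∀ H : SchwartzMap (Fin (n + n') → EuclideanSpace ℝ (Fin 4)) ℂ,
          IsAppendTensorOf H (osAdjoint F) (translateMulti (t • a) G) →
          ∀ᶠ k in Filter.atTop, ‖qcdLatticeDist sch k (n + n') (Fin.append (σ ∘ Fin.rev) σ') H -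
            qcdLatticeDist sch k n (σ ∘ Fin.rev) (osAdjoint F) * qcdLatticeDist sch k n' σ' G‖ ≤ ε) := by
  sorry

/-- (CS) **species Cauchy–Schwarz clustering** — OPEN (infrared, the gap input in OS currency): same hypotheses
with the lattice gap at rate `Δ > 0` (and P2) ⇒ `sch.HasSpeciesCSClustering Δ'` for some `Δ' > 0` (P10; the rate may drop). -/
theorem stub_speciesCSClustering :
    ∀ (Nf : ℕ) (sch : QCDScheme Nf) (Δ : ℝ), 0 < Δ → sch.HasAsymptoticScaling →
    (∀ fl : Fin Nf, ∀ᶠ k in Filter.atTop, -1 < sch.mq fl k) → sch.HasLatticeMassGap Δ →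
    (∀ n : ℕ, n ≠ 0 → ∀ (σ : Fin n → QCDField Nf)
      (f : Fin n → SchwartzMap (EuclideanSpace ℝ (Fin 4)) ℝ) (F : SchwartzMap (Fin n → EuclideanSpace ℝ (Fin 4)) ℂ),
      IsTensorOf F (fun i => ofRealTest (f i)) → IsOffDiagonal F →
        ∃ c : ℂ, Filter.Tendsto (fun k : ℕ => qcdLatticeSchwinger sch k n σ f)
          Filter.atTop (nhds c)) →
    ∀ (s : ℕ) (α β : ℝ), 0 ≤ α →
      (∀ (n : ℕ) (σ : Fin n → QCDField Nf), ∀ᶠ k in Filter.atTop,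
        ∀ F : SchwartzMap (Fin n → EuclideanSpace ℝ (Fin 4)) ℂ, IsOffDiagonal F →
          ‖qcdLatticeDist sch k n σ F‖ ≤ α * (n.factorial : ℝ) ^ β * schwartzNorm (n * s) F) →
    ∃ Δ' > 0, sch.HasSpeciesCSClustering Δ' := by
  sorry

/-- (SOFT) **soft OS closure, scheme-generic** — CLOSED (wave 2, p150754; reshape 3 replaces the reshape-2 statement, whose
registered copy was truncated at the gate's 3900-character cap): for ANY scheme, convergence on off-diagonal real
tensors, the k-uniform E0′ bound (P2), asymptotic translation invariance (P6), eventually approximately positive OS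
forms (P8), k-uniform spatial clustering (P9), the lattice gap at `Δ` and species CS clustering at `Δ'` give a labelled
limit family with E0 (normalisation, hermiticity), E0′, translations on `⁰𝒮`, E2, E3, E4, the convergence-to-`S`
clause and both gaps at one `Δ₀ > 0` — the conclusion of `ConvergentOSClosure` minus its packaging clause (which the
landed `stub_speciesPackaging` supplies in the composition). -/
theorem stub_softClosure :
    ∀ (Nf : ℕ) (sch : QCDScheme Nf), (∀ n : ℕ, n ≠ 0 →
    ∀ (σ : Fin n → QCDField Nf) (f : Fin n → SchwartzMap (EuclideanSpace ℝ (Fin 4)) ℝ) (F : SchwartzMap (Fin n → EuclideanSpace ℝ (Fin 4)) ℂ), IsTensorOf F (fun i => ofRealTest (f i)) → IsOffDiagonal F →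
    ∃ c : ℂ, Filter.Tendsto (fun k : ℕ => qcdLatticeSchwinger sch k n σ f) Filter.atTop (nhds c)) →
    ∀ (s : ℕ) (α β : ℝ), 0 ≤ α →
    (∀ (n : ℕ) (σ : Fin n → QCDField Nf), ∀ᶠ k in Filter.atTop, ∀ F : SchwartzMap (Fin n → EuclideanSpace ℝ (Fin 4)) ℂ, IsOffDiagonal F → ‖qcdLatticeDist sch k n σ F‖ ≤ α * (n.factorial : ℝ) ^ β * schwartzNorm (n * s) F) →
    (∀ (n : ℕ) (σ : Fin n → QCDField Nf) (a : EuclideanSpace ℝ (Fin 4)) (F : SchwartzMap (Fin n → EuclideanSpace ℝ (Fin 4)) ℂ), IsOffDiagonal F → Filter.Tendsto (fun k : ℕ => qcdLatticeDist sch k n σ (translateMulti a F) - qcdLatticeDist sch k n σ F) Filter.atTop (nhds 0)) →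
    (∀ (N : ℕ) (deg : Fin N → ℕ) (lab : (j : Fin N) → Fin (deg j) → QCDField Nf) (G : (j : Fin N) → SchwartzMap (Fin (deg j) → EuclideanSpace ℝ (Fin 4)) ℂ), (∀ j, IsTimeOrdered (G j)) →
    ∀ H : (i j : Fin N) → SchwartzMap (Fin (deg i + deg j) → EuclideanSpace ℝ (Fin 4)) ℂ, (∀ i j, IsAppendTensorOf (H i j) (osAdjoint (G i)) (G j)) →
    ∀ ε : ℝ, 0 < ε →
    ∀ᶠ l in Filter.atTop, -ε ≤ (∑ i, ∑ j, qcdLatticeDist sch l (deg i + deg j) (Fin.append (lab i ∘ Fin.rev) (lab j)) (H i j)).re ∧ |(∑ i, ∑ j, qcdLatticeDist sch l (deg i + deg j) (Fin.append (lab i ∘ Fin.rev) (lab j)) (H i j)).im| ≤ ε) →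
    (∀ (n n' : ℕ) (σ : Fin n → QCDField Nf) (σ' : Fin n' → QCDField Nf) (F : SchwartzMap (Fin n → EuclideanSpace ℝ (Fin 4)) ℂ) (G : SchwartzMap (Fin n' → EuclideanSpace ℝ (Fin 4)) ℂ), IsTimeOrdered F → IsTimeOrdered G →
    ∀ a : EuclideanSpace ℝ (Fin 4), a 0 = 0 → a ≠ 0 →
    ∀ ε : ℝ, 0 < ε →
    ∃ t₀ : ℝ, ∀ t : ℝ, t₀ ≤ t →
    ∀ H : SchwartzMap (Fin (n + n') → EuclideanSpace ℝ (Fin 4)) ℂ, IsAppendTensorOf H (osAdjoint F) (translateMulti (t • a) G) →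
    ∀ᶠ k in Filter.atTop, ‖qcdLatticeDist sch k (n + n') (Fin.append (σ ∘ Fin.rev) σ') H - qcdLatticeDist sch k n (σ ∘ Fin.rev) (osAdjoint F) * qcdLatticeDist sch k n' σ' G‖ ≤ ε) →
    ∀ (Δ Δ' : ℝ), 0 < Δ → 0 < Δ' → sch.HasLatticeMassGap Δ → sch.HasSpeciesCSClustering Δ' →
    ∃ S : LabelledSchwingerFamily (QCDField Nf) (EuclideanSpace ℝ (Fin 4)), S.IsNormalized ∧
      S.IsHermitian ∧
      S.HasLinearGrowth ∧
      (∀ (n : ℕ) (σ : Fin n → QCDField Nf) (a : EuclideanSpace ℝ (Fin 4)) (F : SchwartzMap (Fin n → EuclideanSpace ℝ (Fin 4)) ℂ), IsOffDiagonal F → S n σ (translateMulti a F) = S n σ F) ∧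
      S.IsReflectionPositive ∧
      S.IsSymmetric ∧
      S.HasClusterProperty ∧
      (∀ n : ℕ, n ≠ 0 →
    ∀ (σ : Fin n → QCDField Nf) (f : Fin n → SchwartzMap (EuclideanSpace ℝ (Fin 4)) ℝ) (F : SchwartzMap (Fin n → EuclideanSpace ℝ (Fin 4)) ℂ), IsTensorOf F (fun i => ofRealTest (f i)) → IsOffDiagonal F → Filter.Tendsto (fun k : ℕ => qcdLatticeSchwinger sch k n σ f) Filter.atTop (nhds (S n σ F))) ∧
      (∃ Δ : ℝ, 0 < Δ ∧
      S.HasMassGap Δ ∧ sch.HasLatticeMassGap Δ) :=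
  Summit.QuantumFields.QCD.Theorems.ConvergentOSClosure.stub_softClosure


/-- (S4) gap transfer to a labelled limit without E1 — CLOSED (wave 1, p147450, `Theorems/GapBuysCauchyRateConvergentOSClosureStubGapTransfer.lean`). -/
theorem stub_gapTransfer :
    ∀ (Nf : ℕ) (sch : QCDScheme Nf) (Δ : ℝ)
    (S : LabelledSchwingerFamily (QCDField Nf) (EuclideanSpace ℝ (Fin 4))),
    S.IsNormalized → S.IsTranslationInvariant → S.IsReflectionPositive → S.HasClusterProperty →
    (∀ n : ℕ, n ≠ 0 → ∀ (σ : Fin n → QCDField Nf)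
      (f : Fin n → SchwartzMap (EuclideanSpace ℝ (Fin 4)) ℝ)
      (F : SchwartzMap (Fin n → EuclideanSpace ℝ (Fin 4)) ℂ),
      IsTensorOf F (fun i => ofRealTest (f i)) → IsOffDiagonal F →
        Filter.Tendsto (fun k : ℕ => qcdLatticeSchwinger sch k n σ f)
          Filter.atTop (nhds (S n σ F))) →
    sch.HasSpeciesDiagClustering Δ → S.HasMassGap Δ :=
  Summit.QuantumFields.QCD.Theorems.ConvergentOSClosure.stub_gapTransfer

/-- (S5) packaging and species witnesses — CLOSED (wave 1, p147393, `Theorems/GapBuysCauchyRateConvergentOSClosureStubSpeciesPackaging.lean`). -/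
theorem stub_speciesPackaging :
    ∀ (Nf : ℕ) (reg : QCDRegularisation Nf) (𝒞 : CalibratedSpeciesFamily reg) (m : Fin Nf → ℝ),
    (∀ᶠ k in Filter.atTop,
      (𝒞.scheme m).twoPoint k QCDField.glue QCDField.glue (thetaTest 4 𝒞.f₀) 𝒞.f₀ = 1) →
    (∀ f g : Fin Nf, f ≠ g → ∀ᶠ k in Filter.atTop,
      (𝒞.scheme m).twoPoint k (QCDField.pseudoRe f g) (QCDField.pseudoRe f g)
        (thetaTest 4 𝒞.f₀) 𝒞.f₀ = 1) →
    (∃ f g h : SchwartzMap (EuclideanSpace ℝ (Fin 4)) ℝ,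
      tsupport (f : EuclideanSpace ℝ (Fin 4) → ℝ) ⊆ {x | x 0 < 0} ∧
      tsupport (g : EuclideanSpace ℝ (Fin 4) → ℝ) ⊆ {x | 0 < x 0 ∧ x 0 < 1} ∧
      tsupport (h : EuclideanSpace ℝ (Fin 4) → ℝ) ⊆ {x | 1 < x 0} ∧
      ∃ ε > (0 : ℝ), ∀ᶠ k in Filter.atTop, ε ≤ ‖qcdLatticeSchwinger (𝒞.scheme m) k 3
        ![QCDField.glue, QCDField.glue, QCDField.glue] ![f, g, h] -
        qcdLatticeSchwinger (𝒞.scheme m) k 1 ![QCDField.glue] ![f] *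
          qcdLatticeSchwinger (𝒞.scheme m) k 2 ![QCDField.glue, QCDField.glue] ![g, h] -
        qcdLatticeSchwinger (𝒞.scheme m) k 1 ![QCDField.glue] ![g] *
          qcdLatticeSchwinger (𝒞.scheme m) k 2 ![QCDField.glue, QCDField.glue] ![f, h] -
        qcdLatticeSchwinger (𝒞.scheme m) k 1 ![QCDField.glue] ![h] *
          qcdLatticeSchwinger (𝒞.scheme m) k 2 ![QCDField.glue, QCDField.glue] ![f, g] +
        2 * (qcdLatticeSchwinger (𝒞.scheme m) k 1 ![QCDField.glue] ![f] *
          qcdLatticeSchwinger (𝒞.scheme m) k 1 ![QCDField.glue] ![g] *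
          qcdLatticeSchwinger (𝒞.scheme m) k 1 ![QCDField.glue] ![h])‖) →
    ∀ S : LabelledSchwingerFamily (QCDField Nf) (EuclideanSpace ℝ (Fin 4)),
      OSAxiomsSchwinger S →
      (∀ n : ℕ, n ≠ 0 → ∀ (σ : Fin n → QCDField Nf)
        (f : Fin n → SchwartzMap (EuclideanSpace ℝ (Fin 4)) ℝ)
        (F : SchwartzMap (Fin n → EuclideanSpace ℝ (Fin 4)) ℂ),
        IsTensorOf F (fun i => ofRealTest (f i)) → IsOffDiagonal F →
          Filter.Tendsto (fun k : ℕ => qcdLatticeSchwinger (𝒞.scheme m) k n σ f)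
            Filter.atTop (nhds (S n σ F))) →
      ∃ T : OSData (QCDField Nf) 4, T.schwinger = S ∧ T.IsNontrivial QCDField.glue ∧
        T.IsNonGaussian QCDField.glue ∧
          ∀ f g : Fin Nf, f ≠ g → T.IsNontrivial (QCDField.pseudoRe f g) :=
  Summit.QuantumFields.QCD.Theorems.ConvergentOSClosure.stub_speciesPackaging

/-! ## §2 Composition (kernel-checked; no `sorry` below this line) -/

/-- **The crux from the registered stubs** (the only theorem of this file concluding
`GapBuysCauchyRate.ConvergentOSClosure`, BY NAME): the five lattice-side inputs T, AT, RP, CL, CS are read off the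
crux hypotheses by the open stubs and fed, with the calibration/κ₃/convergence hypotheses, to the soft closure. -/
theorem convergentOSClosure_of_stubs : ConvergentOSClosure := by
  intro Nf reg 𝒞 m hm hAS hbr hgap h2g h2q h3g hconv
  obtain ⟨s, α, β, hα, hb⟩ := stub_tightness Nf reg 𝒞 m hm hAS hbr hgap h2g h2q hconv
  have htr := stub_asymptoticTranslation Nf reg 𝒞 m hm hAS hbr hgap h2g h2q hconv s α β hα hb
  have hrp :
    (∀ (N : ℕ) (deg : Fin N → ℕ) (lab : (j : Fin N) → Fin (deg j) → QCDField Nf)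
      (G : (j : Fin N) → SchwartzMap (Fin (deg j) → EuclideanSpace ℝ (Fin 4)) ℂ), (∀ j, IsTimeOrdered (G j)) →
      ∀ H : (i j : Fin N) → SchwartzMap (Fin (deg i + deg j) → EuclideanSpace ℝ (Fin 4)) ℂ,
        (∀ i j, IsAppendTensorOf (H i j) (osAdjoint (G i)) (G j)) →
        ∀ ε : ℝ, 0 < ε → ∀ᶠ l in Filter.atTop,
          -ε ≤ (∑ i, ∑ j, qcdLatticeDist (𝒞.scheme m) l (deg i + deg j)
            (Fin.append (lab i ∘ Fin.rev) (lab j)) (H i j)).re ∧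
          |(∑ i, ∑ j, qcdLatticeDist (𝒞.scheme m) l (deg i + deg j)
            (Fin.append (lab i ∘ Fin.rev) (lab j)) (H i j)).im| ≤ ε) := by
    by_cases hNf : Nf ≤ 16
    · exact stub_rpOfComparison Nf (𝒞.scheme m)
        (QCDScheme.eventually_le_beta_of_hasAsymptoticScaling hNf (𝒞.scheme m) hAS 0) hbr s α β hα hb
        (stub_thermalComparison Nf (𝒞.scheme m) hNf hAS hbr hgap hconv s α β hα hb)
    · exact stub_approxPositiveFormsLargeNf Nf (𝒞.scheme m) (by omega) hAS hbr hgap hconv s α β hα hb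
  have hcl := stub_spatialClustering Nf (𝒞.scheme m) hAS hbr hgap hconv s α β hα hb
  obtain ⟨Δ, hΔ, hgapΔ⟩ := hgap
  obtain ⟨Δ', hΔ', hCS⟩ := stub_speciesCSClustering Nf (𝒞.scheme m) Δ hΔ hAS hbr hgapΔ hconv s α β hα hb
  obtain ⟨S, h0, h0', hE0', hE1t, hE2, hE3, hE4, htensor, hgap₀⟩ :=
    stub_softClosure Nf (𝒞.scheme m) hconv s α β hα hb htr hrp hcl Δ Δ' hΔ hΔ' hgapΔ hCS
  exact ⟨S, h0, h0', hE0', hE1t, hE2, hE3, hE4, htensor, hgap₀, fun hRot =>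
    stub_speciesPackaging Nf reg 𝒞 m h2g h2q h3g S ⟨⟨h0, h0', ⟨hE1t, hRot⟩, hE2, hE3, hE4⟩, hE0'⟩ htensor⟩

end Summit.QuantumFields.QCD.Cruxes.ConvergentOSClosure.Birth

end
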